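import Summits.QuantumFields.BalabanUV.Beta.NVertexChartGenericObjects
import Summits.QuantumFields.BalabanUV.Beta.FP.CompositeOneShotJetDataSymG
import Summits.QuantumFields.BalabanUV.Beta.NVertexGradedRecordLetters

/-!
# `BalabanUV.Beta.NVertexChartGenericObjectsG` — row D1 ∕ (C1), σ_T (E-AN2-94-3 = road E-FP-73-3): **THE N-SYSTEM's SECOND-ORDER FAMILY THROUGH A GENERIC CHART `A`
# OVER THE GRADED TABLE RECORD** — F-L8 `NVertexChartGenericObjects.WNA` with the ONE token `tabsComp ↦ tabsCompG` (PART 92 `CompositeOneShotJetsGraded.tabsCompG`: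
# `mixFF := compMixG`, every other slot `tabsComp`'s): `WNAG R P A j := WchartOf (fun _ => A) (tabsCompG (j+1) …) (P.c• (j+1)) 0`; the first-order family `VNA` is grading-blind
# (first-order stencils read no mixed table) and is REUSED from F-L8 unchanged — OBJECTS ONLY, plus the one graded table letter the σ_T-proper files need (`compMixG_inr`)
# (β-function cell `pub-balaban`, BINDER-OWNERS row D1 ∕ (C1) OWNER «beta-an2» gen 94, σ_T wave, row side, file 1∕6; journal [AN2-G94-W-18]).

WHY.  The even∕mixed chart-generic files of the (c) wave (`NVertexEvenChartGenericBorder ∕ Carrier ∕ CarrierPeriodised ∕ Torus`, `NVertexChartSymReadings3`) read the record's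
second-order family through `WNA R P A j` over `tabsComp` — SYM2's (R) record, whose (2,3)-model instance does not close by value (`SPAN-SYM2.addendum4` 56c550e9: 1.6e−2 ∕ 1.8 ∕ 0.13);
the by-value-certified tower is the GRADED one (G ✓ 1.5e−12 ∕ D₁⁺ 1.9e−12).  S-END-G (referee #169's key) therefore needs their twins over `tabsCompG`; this file is the common root
object, and `WNAG R P (ANs R Ψs j) j` IS the graded fully-sym family `WNsG` of L-3a (`rfl`, `WNsG_eq_WNAG`).

WHAT ([our object — bookkeeping] one `def` + `rfl` letters + one `simp only` letter; nothing cited, 0 sorry): `WNAG`, `WNAG_eq` (rfl), **`WNsG_eq_WNAG`** (rfl: L-3a's `WNsG R Ψs hΨ P j = WNAG R P (ANs R Ψs j) j`),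
**`compMixG_inr`** (the graded composite mixed table is field–field only: `compMixG … (inr m) b = 0`, `simp only [compMixG, compMixFFG, packFF_inr]` — `NVertexParitiesW.compMix_inr`'s twin, FP-87 refined),
**`M2NG_even_apply_inr_inl`** (the even half of the graded `M2_N` vanishes on `(inr, inl)` — `NVertexEvenBorder.M2N_even_apply_inr_inl`'s twin).
WHAT THIS IS NOT: no (II) control at the rooted record (`WNA_AN : WNA R P (AN R j) j = WN R P j` has no graded analogue — there is no `JNatG`∕`WNG` object in the tree; PART 93 writes the graded
rooted family out in full); not any letter of the even family (files 2–6); nothing of Bałaban's asserted, valued or discharged; 0 estimates; 0∕4 row-D1 binders (hW, hR, D1Tel, D1Rep); NOT (C1),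
NOT (T-ID), NOT D1, NEVER «G-an2-4 closed», NOT BetaPertH, NOT continuum, NOT Clay.

HONEST DEPENDENCY (page 1, mandatory): continuum YM on T⁴ ⇐ BetaPertH ∧ nine spine estimates (0/9 proved); BetaPertH ⇐ (D1) ∧ (D4) ∧ CAP+tail;
G-an2-4 gates asym, D1 and NE2/3/4.  HONEST FRAMING (cell contract, verbatim): «discharging `BetaPertH` makes Bałaban's UV stability UNCONDITIONAL —
a real constructive-QFT result; it is NOT the continuum limit and NOT the Clay problem.»  ABSOLUTE RULE (cell charter, verbatim): «No internally-minted
statement may enter as a cited fact. Every hypothesis is either kernel-proved in this package or a verbatim quotation of a PUBLISHED theorem with page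
reference. The manuscript(s) under audit are NOT citable for their own disputed steps — they are the thing under adjudication; programme-internal
(2001/route/tribunal) claims are never citable.»  Row D1 ∕ (C1) OWNER «beta-an2» gen 94, 2026-08-31.  No existing file touched.
-/

noncomputable section

namespace Summit.QuantumFields.BalabanUV.Beta.NVertexChartGenericObjectsG

open Literature.MathematicalPhysics.QuantumFieldTheory
open Literature.MathematicalPhysics.QuantumFieldTheory.Balaban1983to89
open Literature.MathematicalPhysics.QuantumFieldTheory.Balaban1983to89.Beta
open ExpKernelCalculus (MKer)
open AffineAveraging (Site)
open OneStepResolventKernel (Fib)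
open OneStepKernelFamily (vertexOfK)
open Summit.QuantumFields.BalabanUV.Beta.TameKernelCalculus (Spr)
open Summit.QuantumFields.BalabanUV.Beta.AxialDressingRooted (one_le_of_neZero)
open Summit.QuantumFields.BalabanUV.Beta.ChartStepJets (WchartOf)
open Summit.QuantumFields.BalabanUV.Beta.CompositeOneShotJetsGraded (tabsCompG)
open Summit.QuantumFields.BalabanUV.Beta.CompositeOneShotJetData (Roots Pins)
open Summit.QuantumFields.BalabanUV.Beta.CompositeHessianTable (packFF_inr)
open Summit.QuantumFields.BalabanUV.Beta.CompositeMixedTableGraded (compMixG compMixFFG)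
open Summit.QuantumFields.BalabanUV.Beta.FP.CompositeOneShotJetDataSym (ANs)
open Summit.QuantumFields.BalabanUV.Beta.FP.CompositeOneShotJetDataSymG (WNsG)
open BalabanStepW2 (M2Of)
open Summit.QuantumFields.BalabanUV.Beta.TameKernelCalculus (trK trK_apply)
open Summit.QuantumFields.BalabanUV.Beta.BorderedHessian (sgnK sgnK_apply)
open Summit.QuantumFields.BalabanUV.Beta.CompositeHessianTable (packFF_inl_inr)
open Summit.QuantumFields.BalabanUV.Beta.CompositeOneShotJetsGraded (tabsCompG_mixFF)

section Objects

variable {Lc : ℕ} [NeZero Lc] (R : Roots Lc) (P : Pins) (A : MKer (3 + 1) (Fib 3)) (j : ℕ)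

/-- [our object — bookkeeping] **`WNAG R P A j`** — the N-system's SECOND-ORDER family at depth `j+1` through a GENERIC chart `A` OVER THE GRADED RECORD: F6d-1a `ChartStepJets.WchartOf`
over `tabsCompG (j+1)` (PART 92) and the pins `P.c• (j+1)`, constant chart family `fun _ => A` — F-L8 `WNA` one token over. -/
def WNAG : Fin (3 + 1) → Site (3 + 1) → Fin (3 + 1) → Site (3 + 1) → MKer (3 + 1) (Fib 3) :=
  WchartOf (fun _ => A) (tabsCompG (j + 1) (one_le_of_neZero Lc) R.hr (P.cM (j + 1)))
    (P.cE (j + 1)) (P.cVH (j + 1)) (P.cΛ (j + 1)) (P.cE₂ (j + 1)) (P.cB (j + 1)) (P.T (j + 1)) 0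

/-- `WNAG` unfolded (`rfl`). -/
theorem WNAG_eq : WNAG R P A j = WchartOf (fun _ => A) (tabsCompG (j + 1) (one_le_of_neZero Lc) R.hr (P.cM (j + 1)))
    (P.cE (j + 1)) (P.cVH (j + 1)) (P.cΛ (j + 1)) (P.cE₂ (j + 1)) (P.cB (j + 1)) (P.T (j + 1)) 0 := rfl

/-- [folklore] **`WNsG_eq_WNAG`** (`rfl` through `JsChart0Of_W`): L-3a's graded fully-sym second-order family IS `WNAG` at the L-chart — the junction the graded readers use. -/
theorem WNsG_eq_WNAG (Ψs : ℕ → MKer (3 + 1) (Fib 3)) (hΨ : ∀ m, Spr (Ψs m)) : WNsG R Ψs hΨ P j = WNAG R P (ANs R Ψs j) j := rfl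

end Objects

section Table

variable {d : ℕ}

/-- [folklore] **`compMixG_inr`** — the GRADED composite mixed table is field–field only: every multiplier row vanishes (F0 `compMixG = compMixFFG … = packFF …`, `packFF_inr`) —
`NVertexParitiesW.compMix_inr`'s graded twin. -/
theorem compMixG_inr (r : Fin (d + 1) → ℕ) (L n : ℕ) (κ : Fin (d + 1)) (u : Site (d + 1)) (ρ : Fin (d + 1)) (w x z : Site (d + 1)) (m : Fin (d + 1)) (b : Fib d) :
    compMixG r L n κ u ρ w x z (Sum.inr m) b = 0 := by
  simp only [compMixG, compMixFFG, packFF_inr]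

end Table

section Record

variable {Lc : ℕ} [NeZero Lc] (R : Roots Lc) (P : Pins) (j : ℕ)

/-- [folklore] **the even half of the GRADED `M2_N` vanishes on `(inr, inl)`** (`M2Of = wM2 • mixFF`, `mixFF = compMixG = packFF …` is field–field) — `NVertexEvenBorder.M2N_even_apply_inr_inl`'s
graded twin (the one rooted-record even letter PART 93 `NVertexGradedRecordLetters` does not carry). -/
theorem M2NG_even_apply_inr_inl (κ : Fin (3 + 1)) (u : Fin (3 + 1) → ℤ) (ρ : Fin (3 + 1)) (w x z : Fin (3 + 1) → ℤ) (m₁ β : Fin (3 + 1)) :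
    ((1 / 2 : ℝ) • (M2Of 3 (Lc ^ (j + 1)) (tabsCompG (j + 1) (one_le_of_neZero Lc) R.hr (P.cM (j + 1))).mixFF 0 κ u ρ w + sgnK (trK (M2Of 3 (Lc ^ (j + 1)) (tabsCompG (j + 1) (one_le_of_neZero Lc) R.hr (P.cM (j + 1))).mixFF 0 κ u ρ w)))) x z (Sum.inr m₁) (Sum.inl β) = 0 := by
  have h1 : (tabsCompG (j + 1) (one_le_of_neZero Lc) R.hr (P.cM (j + 1))).mixFF κ u ρ w x z (Sum.inr m₁) (Sum.inl β) = 0 := by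
    rw [tabsCompG_mixFF]; exact compMixG_inr _ _ _ κ u ρ w x z m₁ _
  have h2 : (tabsCompG (j + 1) (one_le_of_neZero Lc) R.hr (P.cM (j + 1))).mixFF κ u ρ w z x (Sum.inl β) (Sum.inr m₁) = 0 := by
    rw [tabsCompG_mixFF]; simp only [compMixG, compMixFFG, packFF_inl_inr]
  simp only [M2Of, Pi.smul_apply, Pi.add_apply, smul_eq_mul, sgnK_apply, trK_apply, h1, h2, mul_zero, add_zero]

end Record

end Summit.QuantumFields.BalabanUV.Beta.NVertexChartGenericObjectsG

end
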